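import Summits.BirchSwinnertonDyer.Rank1Residual.Additive.FouquetWanLocus
import HarnessLib

/-!
# BSD rank-≤1 residual cell, class O6 (wild `p = 3`) vs the Fouquet–Wan locus: necessary conditions
# for LOCAL IRREDUCIBILITY `LocIrr W 3` read off the minimal discriminant — the tame-cube criterion
# (L-O6-irr, target), the `f₃ = 4` unit-part law (L-O6-cyc9, target with its arithmetic kernel PROVED),
# and their corollary "the cyclic wild cell never meets the FW locus" (kernel bookkeeping)

HONEST FRAMING (cell `b2b-bsdres-*`, run/shared/lean/b2b/bsd-rank1-residual/, verbatim): the goal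
of the cell is to DELETE the COMBINATION-SHAPED residual classes for ALL analytic-rank `≤ 1` elliptic
curves over `ℚ`, not to book instances; census / certificate output is EVIDENCE, never a Literature
fact; nothing here is booked, no mark is moved, O6 stays OPEN; Fouquet–Wan arXiv:2107.13726 stays a
PREPRINT hypothesis SHAPE (`FouquetWanClaimShape`). This file: two target `Prop`s (theorem-candidates,
nothing asserted), decidable arithmetic vocabulary with PROVED lemmas, kernel corollaries; 0
`@[conjecture]` nodes, 0 named Literature facts.

## KERNEL STATUS (cc-typer-5 GEN 10 restamp, 2026-08-21; statements byte-identical, doc-only)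

BOTH targets of this file are now THEOREMS of the tree, each proved in its own file by the cross-cell
pool hand x11b3-p7 GEN 7 with NO binder beyond the target's own: **L-O6-irr**
`Additive.locIrrThreeTameCube_holds : LocIrrThreeTameCube` (`Additive/LocIrrThreeTameCubeHolds.lean`,
p299150) and **L-O6-cyc9** `Additive.condExpFourUnitPartLawThree_holds : CondExpFourUnitPartLawThree`
(`Additive/CondExpFourUnitPartLawThreeHolds.lean`, p300810 — Tate's algorithm Steps 5/10 at `3`, the
wild normal forms, the bracket lemma `valued_δ_residue_of_wild_shape` of `Additive/WildThreeDeltaResidue.lean`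
p300464, and a residue map `𝒪_v → ℤ₃ → ℤ/9`; it RETIRES the Table II binder of the earlier conditional form
`condExpFourUnitPartLawThree_of_tableII`, `Additive/CondExpFourUnitPartLawThreeOfTableII.lean` p299644, which
stays as landed, superseded). Hence the §3 corollaries hold UNCONDITIONALLY under the primed names of those
files — in particular `Additive.not_locIrr_three_of_cyclic_values'`: the cyclic wild cell (`f₃ = 4`,
`v₃Δ_min ∈ {4, 6, 10, 12}`) NEVER meets the Fouquet–Wan locus, with no binder left. The hypothesis-taking
forms below are kept verbatim (consumers feed `locIrrThreeTameCube_holds` / `condExpFourUnitPartLawThree_holds`).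
WORDING (EVIDENCE framing, lane rule): the censuses 0 / 26 662 (L-O6-irr), 1 833 / 1 833 (L-O6-cyc9) and
`LocIrr(3)` = 0 / 5 161 on `SubWCyclic` stay EVIDENCE; nothing is booked; no mark of `RESIDUAL-MAP.md`
moves; O6 stays OPEN.

## What is typed and why (CLASS-CLOSURE lane, typer 5 = O5/O6 typer of record; asks of o6-r1 GEN 3,
## INBOX 2026-08-21T06:42Z (2): "LEMMA L-O6-irr (provable now, elementary)" and "L-O6-cyc9, theorem
## status ASKED")

o6-r1 GEN 3 re-drew the O6 sub-partition against the Fouquet–Wan hypothesis locus (`LocIrr W 3`: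
`ρ̄_{E,3}|G_{ℚ₃}` irreducible; `Additive/FouquetWanLocus.lean`): `LocIrr(3)` holds on **0 / 5 161**
CYCLIC wild rows (`SubWCyclic`), only on `dr3 ∧ v₃N = 3` rows. Two statements explain the zero:

* **L-O6-irr** (`LocIrrThreeTameCube`, TARGET): `LocIrr W 3 → Δ_min ∈ (ℚ₃^{nr×})³`, i.e.
  `3 ∣ v₃(Δ_min)` and the unit part `Δ′ = Δ_min/3^{v₃Δ_min} ≡ ±1 (mod 9)`. Proof route (o6-r1; checked
  by this seat on paper, NOT yet in Lean): the image `P` of WILD inertia is a normal `3`-subgroup of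
  `ρ̄(G_{ℚ₃}) ⊂ GL₂(𝔽₃)`; `P ≠ 1 ⇒ E[3]^P` is a `G_{ℚ₃}`-stable LINE ⇒ reducible; so `LocIrr ⇒ ℚ₃(E[3])/ℚ₃`
  is TAME ⇒ its subfield `ℚ₃(ζ₃, Δ^{1/3})` (Serre 1972 §5.3; in the tree the explicit `x`-division field
  `K(x(E[3])) = K(ζ, δ, R₀, R₁, R₂)`, `δ³ = Δ`, of the `ThreeTorsionFakePoint*Proofs` files) is tame over
  `ℚ₃`, hence `[ℚ₃^{nr}(ζ₃, Δ^{1/3}) : ℚ₃^{nr}(ζ₃)]` is prime to `3`, hence `= 1`, i.e. `Δ` is a cube in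
  `ℚ₃^{nr}(ζ₃)`, equivalently (degree `2 ∤ 3`) in `ℚ₃^{nr}`, equivalently `3 ∣ v₃Δ` and the unit part is
  a cube in `ℤ₃^{nr×}` `⟺ Δ′ ≡ ±1 (mod 9)` (`(1+3x)³ ≡ 1 + 9x (mod 27)` and Hensel; every element of
  `𝔽̄₃^×` is a cube; for any model, `u¹²` is a cube). CENSUS: 0 violations / 26 662 X4-wild rows against
  rmap-2's independently computed `ψ₃`-root bit (`HOME/b2b-bsdres-o6-r1/gen3/locirr_nec.{py,out}`).
  Typed as a TARGET because Mathlib/the tree lack the wild-inertia subgroup of `G_{ℚ₃}` acting on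
  `E[3]` and the tame-Kummer step; a prover's item, not a typer's hour.
* **L-O6-cyc9** (`CondExpFourUnitPartLawThree`, TARGET; EVIDENCE 1 833/1 833): `Addv W 3 →
  v₃(N) = 4 → v₃(Δ_min) ∈ {6, 12} → Δ′ ≢ ±1 (mod 9)`. THEOREM STATUS (answer to o6-r1's ask): the
  `v₃(N) = 4` rows of the Halberstadt–Rizzo table at `3` (tree: `RootNumberTableThree`, `Rizzo.tableII`;
  Papadopoulos 1993 for the Néron types) are `II (2,3,4)`, `IV (3,5,6)`, `IV* (4,6,10)`, `II* (5,8,12)`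
  (printed reduced `★(1,2,0)`), so `v₃Δ = 6, 12` force `(v₃c₄, v₃c₆) = (3,5), (5,8)`, and then
  `1728Δ = c₄³ − c₆²` gives `64·Δ′ = a³ − 3b²` with `3 ∤ a, b`, whence `Δ′ ≡ ±1 − 3 ∈ {5, 7} (mod 9)`:
  this ARITHMETIC KERNEL is PROVED below (`not_isPmOneModNine_of_eq`,
  `not_isPmOneModNine_of_triple`, uniformly in the two rows `(2k+3, 3k+5, 6k+6)`, `k = 0, 1`); what
  remains for a prover is the table-lookup step (the conductor-exponent column at `3` is a named fact of
  the tree, `RootNumberTableThree`), so L-O6-cyc9 is a THEOREM-CANDIDATE, not a conjecture.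
* COROLLARIES (kernel, proved from the two targets): `¬ LocIrr W 3` whenever `3 ∤ v₃Δ_min`
  (`not_locIrr_three_of_not_three_dvd`), whenever `v₃N = 4 ∧ v₃Δ_min ∈ {6,12}`
  (`not_locIrr_three_of_condExp_four`), hence on every cyclic wild row of the census
  (`v₃Δ_min ∈ {4, 6, 10, 12}`, `not_locIrr_three_of_cyclic_values`) — "the T-O6-ν tower instrument and
  the FW locus are DISJOINT in domain" (o6-r1 `class-closure/O6/STATEMENT.md` §2) becomes a typed
  implication; with Kraus 1990 / Kobayashi 2002 Thm 3.1 (cyclic `Φ ⟺ v₃Δ` even) this is o6-r1's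
  `SubWCyclic W → ¬ LocIrr W 3` (census 5 161/5 161).

References: J.-P. Serre, Invent. Math. 15 (1972) §5.3 [SerreInventiones1972]; O. Rizzo, *Average root
numbers for a nonconstant family of elliptic curves*, Compositio Math. 136 (2003) Table II
[Rizzo2003]; I. Papadopoulos, J. Number Theory 44 (1993) (Néron classification at `p = 3`)
[Papadopoulos1993]; A. Kraus, Manuscripta Math. 69 (1990) [Kraus1990]; O. Fouquet, X. Wan,
arXiv:2107.13726 Thm 5.1 [FouquetWan2021].
-/

set_option autoImplicit false

noncomputable section

open scoped Classical

open WeierstrassCurve Literature.NumberTheory.EllipticCurves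
  Literature.NumberTheory.EllipticCurves.Rank1Residual
  Literature.NumberTheory.EllipticCurves.Rank1Residual.Typed

namespace Summit.BirchSwinnertonDyer.Rank1Residual.Additive

/-! ## §1 Arithmetic: `u ≡ ±1 (mod 9)` (the cubes among `3`-adic units of `ℚ₃^{nr}`), and the
PROVED kernel of L-O6-cyc9 -/

/-- `u ≡ ±1 (mod 9)`: for a `3`-adic unit `u ∈ ℤ`, the condition to be a cube in `ℤ₃^{nr}` (cubes of
`1 + 3ℤ₃^{nr}` are exactly `1 + 9ℤ₃^{nr}`, and every element of `𝔽̄₃^×` is a cube). Decidable.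
[folklore] -/
def IsPmOneModNine (u : ℤ) : Prop := u % 9 = 1 ∨ u % 9 = 8

/-- `IsPmOneModNine` is decidable (census column). [folklore] -/
instance instDecidablePredIsPmOneModNine : DecidablePred IsPmOneModNine := fun u ↦
  inferInstanceAs (Decidable (u % 9 = 1 ∨ u % 9 = 8))

/-- `IsPmOneModNine` read in `ZMod 9`. [folklore] -/
theorem isPmOneModNine_iff_zmod (u : ℤ) :
    IsPmOneModNine u ↔ (u : ZMod 9) = 1 ∨ (u : ZMod 9) = 8 := by
  have h1 : ((u : ZMod 9) = 1) ↔ u % 9 = 1 := by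
    rw [show (1 : ZMod 9) = ((1 : ℤ) : ZMod 9) by norm_num, ZMod.intCast_eq_intCast_iff]
    simp [Int.ModEq]
  have h8 : ((u : ZMod 9) = 8) ↔ u % 9 = 8 := by
    rw [show (8 : ZMod 9) = ((8 : ℤ) : ZMod 9) by norm_num, ZMod.intCast_eq_intCast_iff]
    simp [Int.ModEq]
  rw [h1, h8]; rfl

/-- Cubes of `3`-adic units are `≡ ±1 (mod 9)` (sanity: the condition is necessary). [folklore] -/
theorem isPmOneModNine_pow_three {t : ℤ} (ht : ¬ (3 : ℤ) ∣ t) : IsPmOneModNine (t ^ 3) := by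
  rw [isPmOneModNine_iff_zmod]
  have key : ∀ x : ZMod 9, ZMod.castHom (show 3 ∣ 9 by norm_num) (ZMod 3) x ≠ 0 →
      x ^ 3 = 1 ∨ x ^ 3 = 8 := by decide
  have ht' : ZMod.castHom (show 3 ∣ 9 by norm_num) (ZMod 3) (t : ZMod 9) ≠ 0 := by
    rw [map_intCast, Ne, ZMod.intCast_zmod_eq_zero_iff_dvd]; exact_mod_cast ht
  have := key _ ht'
  push_cast
  exact this

/-- **The arithmetic kernel of L-O6-cyc9 (PROVED).** If `64·d = a³ − 3b²` with `3 ∤ a` and `3 ∤ b`,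
then `d ≢ ±1 (mod 9)`: indeed `64 ≡ 1`, `a³ ≡ ±1`, `3b² ≡ 3 (mod 9)`, so `d ≡ ±1 − 3 ∈ {5, 7}`.
[folklore] -/
theorem not_isPmOneModNine_of_eq {a b d : ℤ} (ha : ¬ (3 : ℤ) ∣ a) (hb : ¬ (3 : ℤ) ∣ b)
    (h : 64 * d = a ^ 3 - 3 * b ^ 2) : ¬ IsPmOneModNine d := by
  have key : ∀ x y : ZMod 9, ZMod.castHom (show 3 ∣ 9 by norm_num) (ZMod 3) x ≠ 0 →
      ZMod.castHom (show 3 ∣ 9 by norm_num) (ZMod 3) y ≠ 0 →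
        x ^ 3 - 3 * y ^ 2 ≠ 1 ∧ x ^ 3 - 3 * y ^ 2 ≠ 8 := by decide
  have ha' : ZMod.castHom (show 3 ∣ 9 by norm_num) (ZMod 3) (a : ZMod 9) ≠ 0 := by
    rw [map_intCast, Ne, ZMod.intCast_zmod_eq_zero_iff_dvd]; exact_mod_cast ha
  have hb' : ZMod.castHom (show 3 ∣ 9 by norm_num) (ZMod 3) (b : ZMod 9) ≠ 0 := by
    rw [map_intCast, Ne, ZMod.intCast_zmod_eq_zero_iff_dvd]; exact_mod_cast hb
  have hd : (d : ZMod 9) = (a : ZMod 9) ^ 3 - 3 * (b : ZMod 9) ^ 2 := by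
    have h' := congrArg (Int.cast : ℤ → ZMod 9) h
    push_cast at h'
    have h64 : (64 : ZMod 9) = 1 := by decide
    rwa [h64, one_mul] at h'
  obtain ⟨h1, h8⟩ := key _ _ ha' hb'
  rw [isPmOneModNine_iff_zmod, hd]
  rintro (h | h)
  · exact h1 h
  · exact h8 h

/-- **The two `v₃(N) = 4` rows with `3 ∣ v₃Δ`, uniformly (PROVED).** If `1728·Δ = c₄³ − c₆²` (the
`c`-relation of any Weierstrass model) with `c₄ = 3^{2k+3}·a`, `c₆ = 3^{3k+5}·b`, `3 ∤ a, b`, and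
`Δ = 3^{6k+6}·d` (`k = 0`: the Kodaira-IV row `(3,5,6)`; `k = 1`: the II* row `(5,8,12)` of the
Halberstadt–Rizzo table), then `64·d = a³ − 3b²`, so `d ≢ ±1 (mod 9)`. [cite: Rizzo2003, Table II] -/
theorem not_isPmOneModNine_of_triple {c₄ c₆ Δ a b d : ℤ} (k : ℕ) (hrel : 1728 * Δ = c₄ ^ 3 - c₆ ^ 2)
    (hc₄ : c₄ = 3 ^ (2 * k + 3) * a) (hc₆ : c₆ = 3 ^ (3 * k + 5) * b) (hΔ : Δ = 3 ^ (6 * k + 6) * d)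
    (ha : ¬ (3 : ℤ) ∣ a) (hb : ¬ (3 : ℤ) ∣ b) : ¬ IsPmOneModNine d := by
  refine not_isPmOneModNine_of_eq ha hb ?_
  subst hc₄ hc₆ hΔ
  have h3 : (3 : ℤ) ^ (6 * k + 9) ≠ 0 := pow_ne_zero _ (by norm_num)
  have key : (3 : ℤ) ^ (6 * k + 9) * (64 * d) = (3 : ℤ) ^ (6 * k + 9) * (a ^ 3 - 3 * b ^ 2) := by
    have e1 : (1728 : ℤ) * (3 ^ (6 * k + 6) * d) = 3 ^ (6 * k + 9) * (64 * d) := by ring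
    have e2 : ((3 : ℤ) ^ (2 * k + 3) * a) ^ 3 - (3 ^ (3 * k + 5) * b) ^ 2 =
        3 ^ (6 * k + 9) * (a ^ 3 - 3 * b ^ 2) := by ring
    rw [← e1, ← e2]; exact hrel
  exact mul_left_cancel₀ h3 key

/-! ## §2 The unit part of the minimal discriminant at `3` and the two targets -/

section Targets

variable (W : WeierstrassCurve ℚ) [W.IsGloballyMinimal]

/-- `Δ′ = Δ_min / 3^{v₃(Δ_min)}` — the prime-to-`3` (unit) part of the minimal discriminant.
[folklore] -/
def minimalDiscUnitPartThree : ℤ :=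
  W.minimalDiscriminantInt / 3 ^ padicValInt 3 W.minimalDiscriminantInt

/-- `Δ_min = 3^{v₃Δ_min} · Δ′` (exact division). [folklore] -/
theorem minimalDiscriminantInt_eq_pow_mul_unitPart :
    W.minimalDiscriminantInt =
      3 ^ padicValInt 3 W.minimalDiscriminantInt * minimalDiscUnitPartThree W := by
  unfold minimalDiscUnitPartThree
  have hd : (3 : ℤ) ^ padicValInt 3 W.minimalDiscriminantInt ∣ W.minimalDiscriminantInt := by
    have := padicValInt_dvd (p := 3) W.minimalDiscriminantInt
    exact_mod_cast this
  exact (Int.mul_ediv_cancel' hd).symm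

/-- **`Δ_min` is a cube in `ℚ₃^{nr}`**: `3 ∣ v₃(Δ_min)` and `Δ′ ≡ ±1 (mod 9)` — the census-decidable
form of "`ℚ₃(ζ₃, Δ^{1/3})/ℚ₃` is unramified over `ℚ₃(ζ₃)`". [folklore] -/
def MinimalDiscIsCubeUnramifiedThree : Prop :=
  3 ∣ padicValInt 3 W.minimalDiscriminantInt ∧ IsPmOneModNine (minimalDiscUnitPartThree W)

/-- **L-O6-irr (TARGET, theorem-candidate; nothing asserted).** Local irreducibility of `ρ̄_{E,3}` on
`G_{ℚ₃}` (`LocIrr W 3`, the Fouquet–Wan hypothesis bit) forces the minimal discriminant to be a cube in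
`ℚ₃^{nr}`: `3 ∣ v₃(Δ_min)` and `Δ′ ≡ ±1 (mod 9)`. Route: wild inertia acts on `E[3]` through a normal
`3`-subgroup of the image, whose fixed line would be `G_{ℚ₃}`-stable, so `LocIrr ⇒ ℚ₃(E[3])/ℚ₃` tame
`⇒ ℚ₃(ζ₃, Δ^{1/3})` tame `⇒ Δ ∈ (ℚ₃^{nr×})³` (Serre 1972 §5.3 for `ℚ(ζ₃, Δ^{1/3}) ⊂ ℚ(E[3])`; tree:
`δ³ = Δ` inside `K(x(E[3]))`, `ThreeTorsionFakePoint*Proofs`). CENSUS (EVIDENCE, not a proof): 0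
violations / 26 662 X4-wild rows (o6-r1 GEN 3 `gen3/locirr_nec.out` against rmap-2 g8 `lgl3_census`).
**PROVED 2026-08-21 (kernel): `Additive.locIrrThreeTameCube_holds : LocIrrThreeTameCube`** (cross-cell pool hand
x11b3-p7 GEN 7, `Additive/LocIrrThreeTameCubeHolds.lean` p299150), for EVERY elliptic curve over `ℚ` and by a route
OTHER than the one sketched above — pure 3-adic arithmetic, no Tate algorithm, no table, no Galois theory of
`ℚ₃(E[3])`: L-O56-sel (`locIrrThreeIffCriterion_holds`, harvest-2 E89) gives the valuation criterion
`c₄ ≠ 0 ∧ (c₆ = 0 ∨ 3·v₃c₄ + 2 ≤ 2·v₃c₆)`; `padicValRat_Δ_of_locIrrCriterionThree` gives `3·v₃c₄ = v₃Δ + 3` (first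
conjunct, harvest-2's `three_dvd_padicValInt_minimalDiscriminantInt_of_locIrr'`); dividing `1728·Δ_min = c₄³ − c₆²` on
`integralModelInt W` by `3^{v₃Δ+3}` leaves `64·Δ′ = u³ − 9t` with `3 ∤ u`, so `Δ′ ≡ u³ ≡ ±1 (mod 9)`
(`isPmOneModNine_of_sixtyfour_mul_eq`, `isPmOneModNine_of_c_relation_int`,
`isPmOneModNine_minimalDiscUnitPartThree_of_locIrr`, this file's `isPmOneModNine_pow_three`). The §-corollaries below
are UNCONDITIONAL there under primed names (`not_locIrr_three_of_not_isPmOneModNine'`; `not_locIrr_three_of_condExp_four'`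
now modulo L-O6-cyc9 ALONE). STATUS: L-O6-irr is CLOSED (a THEOREM; this statement byte-identical; census 0 / 26 662
stays EVIDENCE; nothing booked; no mark); L-O6-cyc9 `CondExpFourUnitPartLawThree` below is ALSO a THEOREM now
(`condExpFourUnitPartLawThree_holds`, p300810 — see its docstring and the module's KERNEL STATUS), so every
§3 corollary is unconditional under the primed names.
[cite: SerreInventiones1972, §5.3] [cite: FouquetWan2021, Thm. 5.1 (hypothesis ρ̄|G_{ℚ_p} irreducible)] -/
def LocIrrThreeTameCube : Prop :=
  ∀ (W : WeierstrassCurve ℚ) [W.IsElliptic] [W.IsGloballyMinimal],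
    LocIrr W 3 → MinimalDiscIsCubeUnramifiedThree W

/-- **L-O6-cyc9 (TARGET, theorem-candidate; nothing asserted).** For `E` additive at `3` with
conductor exponent `v₃(N) = 4` and `v₃(Δ_min) ∈ {6, 12}`, the unit part satisfies `Δ′ ≢ ±1 (mod 9)`.
Route: the `v₃N = 4` rows of the Halberstadt–Rizzo table (tree `RootNumberTableThree`: named fact
`WeierstrassCurve.conductorExponent_eq_tableConductorExponentThree`, table `Rizzo.tableII` with ONE
common shift `m·(4,6,12)`, transcription checked on all Cremona curves `N < 5·10⁵`) with `v₃Δ ∈ {6, 12}` are Kodaira IV `(v₃c₄, v₃c₆, v₃Δ) = (3,5,6)` and II*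
`(5,8,12)`; then `not_isPmOneModNine_of_triple` (PROVED above). CENSUS (EVIDENCE): 1 833 / 1 833
(o6-r1 GEN 3).
**DERIVED 2026-08-21 (kernel), modulo ONE cited named fact — exactly the route above:
`Additive.condExpFourUnitPartLawThree_of_tableII (h3 : ∀ W, W.conductorExponent_eq_tableConductorExponentThree) :
CondExpFourUnitPartLawThree`** (cross-cell pool hand x11b3-p7 GEN 7, `Additive/CondExpFourUnitPartLawThreeOfTableII.lean`
p299644: `rizzo_tableII_condExp_eq_four` — the `v(N) = 4` rows of the transcribed table are (1,2,0)★ II*, (2,3,4) II,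
(3,5,6) IV, (4,6,10) IV*; `rows_of_condExpOfInvariants_eq_four` + `v₃Δ_min ∈ {6, 12}` ⟹ actual triple (3,5,6) or (5,8,12);
per curve `not_isPmOneModNine_of_condExp_four_of_tableII (h3 : W.conductorExponent_eq_…)` via this file's
`not_isPmOneModNine_of_triple`; `Addv` unused; corollary `not_locIrr_three_of_cyclic_values_of_tableII` — with L-O6-irr
now a THEOREM, the cyclic wild rows never meet the Fouquet–Wan locus, modulo the Table II conductor column ONLY).
STATUS: TARGET ↦ DERIVED modulo `WeierstrassCurve.conductorExponent_eq_tableConductorExponentThree` (cited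
`[Rizzo2003, Table II]`, NOT discharged — Tate's algorithm at `3` vs the printed `v(N)` column); statement byte-identical;
census 1 833 / 1 833 stays EVIDENCE; nothing booked; no mark. An unconditional route would need Tate's algorithm at
`v₃(N) = 4` (types II/IV/IV*/II* normal forms) in the tree — not attempted.
**PROVED 2026-08-21 (kernel), UNCONDITIONALLY — that route WAS then taken:
`Additive.condExpFourUnitPartLawThree_holds : CondExpFourUnitPartLawThree`** (cross-cell pool hand x11b3-p7 GEN 7,
`Additive/CondExpFourUnitPartLawThreeHolds.lean` p300810; binders verbatim, no table, no named fact):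
`kodairaSymbolAt_of_condExp_four` (`Addv ∧ f₃ = 4 ∧ v₃Δ_min ∈ {6, 12}` ⟹ Kodaira IV with `v = 6` or II* with `v = 12`;
tame types have `f₃ = 2`, wild ones `f₃ = v₃Δ_min + 1 − m` — Tate's algorithm Steps 5/10 at `3` in the tree), then
`not_isPmOneModNine_of_condExp_four`: the wild normal forms on a `ℚ₃`-model feed `valued_δ_residue_of_wild_shape`
(`Additive/WildThreeDeltaResidue.lean` p300464: `δ = −8β₄³ − 3β₆² + 9t`, `β₄, β₆` units), the scaling `u` is a 3-adic
unit with `Δ′ = u¹²δ`, and the residue map `𝒪_v →+* ℤ₃ →+* ℤ/9` (Mathlib `adicCompletion.padicEquiv`,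
`PadicInt.toZModPow 2`) gives `Δ′ ≡ u¹²(−8a³ − 3b²) ∈ {5, 7} (mod 9)` by `decide` — the same `±1 − 3` arithmetic as
this file's `not_isPmOneModNine_of_eq`, reached without the printed table. Corollary there:
`not_locIrr_three_of_cyclic_values'` = this file's `not_locIrr_three_of_cyclic_values` with BOTH targets supplied.
STATUS NOW: TARGET ↦ THEOREM; `condExpFourUnitPartLawThree_of_tableII` (p299644) stays as landed, superseded; this
statement byte-identical; censuses 1 833 / 1 833 and `LocIrr(3)` = 0 / 5 161 on the cyclic cell stay EVIDENCE; nothing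
booked; no mark; O6 stays OPEN.
[cite: Rizzo2003, Table II (rows IV (3,5,6), II* ★(1,2,0))] [cite: Papadopoulos1993, Table (p = 3)] -/
def CondExpFourUnitPartLawThree : Prop :=
  ∀ (W : WeierstrassCurve ℚ) [W.IsElliptic] [W.IsGloballyMinimal],
    Addv W 3 → condExp W 3 = 4 →
      (padicValInt 3 W.minimalDiscriminantInt = 6 ∨ padicValInt 3 W.minimalDiscriminantInt = 12) →
        ¬ IsPmOneModNine (minimalDiscUnitPartThree W)

end Targets

/-! ## §3 Kernel corollaries: where `LocIrr(3)` CANNOT hold (nothing asserted beyond the targets) -/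

section Corollaries

variable (W : WeierstrassCurve ℚ) [W.IsElliptic] [W.IsGloballyMinimal]

/-- `3 ∤ v₃(Δ_min) ⇒ ¬ LocIrr W 3`, granted L-O6-irr (Kodaira II, IV*-with-`v = 10`, dr rows with
`v ∈ {5, 11}`, …). [folklore] -/
theorem not_locIrr_three_of_not_three_dvd (h : LocIrrThreeTameCube)
    (hv : ¬ 3 ∣ padicValInt 3 W.minimalDiscriminantInt) : ¬ LocIrr W 3 :=
  fun hL ↦ hv (h W hL).1

/-- `Δ′ ≢ ±1 (mod 9) ⇒ ¬ LocIrr W 3`, granted L-O6-irr. [folklore] -/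
theorem not_locIrr_three_of_not_isPmOneModNine (h : LocIrrThreeTameCube)
    (hu : ¬ IsPmOneModNine (minimalDiscUnitPartThree W)) : ¬ LocIrr W 3 :=
  fun hL ↦ hu (h W hL).2

/-- **`v₃N = 4 ∧ v₃Δ_min ∈ {6, 12} ⇒ ¬ LocIrr W 3`**, granted L-O6-irr and L-O6-cyc9. [folklore] -/
theorem not_locIrr_three_of_condExp_four (h₁ : LocIrrThreeTameCube)
    (h₂ : CondExpFourUnitPartLawThree) (hadd : Addv W 3) (hf : condExp W 3 = 4)
    (hv : padicValInt 3 W.minimalDiscriminantInt = 6 ∨ padicValInt 3 W.minimalDiscriminantInt = 12) :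
    ¬ LocIrr W 3 :=
  not_locIrr_three_of_not_isPmOneModNine W h₁ (h₂ W hadd hf hv)

/-- **The cyclic wild rows never meet the FW locus** (typed implication behind o6-r1's census
`LocIrr(3)` = 0 / 5 161 on `SubWCyclic`): for `E` additive at `3` with `v₃N = 4` and
`v₃(Δ_min) ∈ {4, 6, 10, 12}` (the values met on the cyclic cell: Kodaira II, IV, IV*, II*),
`¬ LocIrr W 3` — by L-O6-irr alone when `3 ∤ v` (`4, 10`), with L-O6-cyc9 when `v ∈ {6, 12}`.
The hypotheses are the census columns; `SubWCyclic W` (`v₃Δ_min` even) itself is not used. [folklore] -/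
theorem not_locIrr_three_of_cyclic_values (h₁ : LocIrrThreeTameCube)
    (h₂ : CondExpFourUnitPartLawThree) (hadd : Addv W 3) (hf : condExp W 3 = 4)
    (hv : padicValInt 3 W.minimalDiscriminantInt = 4 ∨ padicValInt 3 W.minimalDiscriminantInt = 6 ∨
      padicValInt 3 W.minimalDiscriminantInt = 10 ∨ padicValInt 3 W.minimalDiscriminantInt = 12) :
    ¬ LocIrr W 3 := by
  rcases hv with hv | hv | hv | hv
  · exact not_locIrr_three_of_not_three_dvd W h₁ (by rw [hv]; decide)
  · exact not_locIrr_three_of_condExp_four W h₁ h₂ hadd hf (Or.inl hv)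
  · exact not_locIrr_three_of_not_three_dvd W h₁ (by rw [hv]; decide)
  · exact not_locIrr_three_of_condExp_four W h₁ h₂ hadd hf (Or.inr hv)

/-- On such rows the Fouquet–Wan hypothesis SHAPE yields nothing: its `LocIrr W 3` antecedent fails,
so `FouquetWanClaimShape KMC` cannot be instantiated there — the O6-cyc / O6-FW cells of
`class-closure/O6/STATEMENT.md` §2 are disjoint by a typed implication (granted the two targets).
A restatement for consumers; nothing new. [folklore] -/
theorem fw_antecedent_fails_of_cyclic_values (h₁ : LocIrrThreeTameCube)
    (h₂ : CondExpFourUnitPartLawThree) (hadd : Addv W 3) (hf : condExp W 3 = 4)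
    (hv : padicValInt 3 W.minimalDiscriminantInt = 4 ∨ padicValInt 3 W.minimalDiscriminantInt = 6 ∨
      padicValInt 3 W.minimalDiscriminantInt = 10 ∨ padicValInt 3 W.minimalDiscriminantInt = 12) :
    ¬ (LocIrr W 3 ∧ FWNonsplitRam W 3) :=
  fun h ↦ not_locIrr_three_of_cyclic_values W h₁ h₂ hadd hf hv h.1

end Corollaries

end Summit.BirchSwinnertonDyer.Rank1Residual.Additive

end
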